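import Literature.NumberTheory.GaloisRepresentations.TateH2VanishingReduction
import HarnessLib

/-!
# `H²(C, ℚ/ℤ) = 0` for a finite cyclic group `C`, cochain form (the archimedean local case of
# Tate's theorem; Serre, Durham 1977, §6.5 (b): "The case when `K` is Archimedean is trivial")

Sibling proof file of `TateProjectiveLifting.lean` (theorems only).  For the archimedean places
in Tate's theorem `H²(G_K, ℚ/ℤ) = 0` one needs the local statement for `G_{K_v} = Gal(ℂ/ℝ)`
(cyclic of order `2`) or `Gal(ℂ/ℂ) = 1`; Serre dismisses it as trivial: for a finite cyclic group
`C` of order `N` acting trivially on a divisible group `A`, `H²(C, A) ≅ Ĥ⁰(C, A) = A / N A = 0`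
(Serre, *Corps locaux*, VIII §4; Cassels–Fröhlich IV §8).  We give the cocycle-level proof:

* `twoCocycle_addCircle_split_of_isCyclic` — **on a finite cyclic group every `2`-cocycle
  `C × C → ℚ/ℤ` (trivial action) is a coboundary.**  With a generator `s` of order `N` and
  `c ∈ ℚ/ℤ` chosen with `N c = ∑_{i<N} f(sⁱ, s)` (divisibility), the function
  `B(k) = k c - ∑_{i<k} f(sⁱ, s) + f(1,1)` is `N`-periodic, hence defines `b(sᵏ) = B(k)`, and
  `f(sⁱ, sʲ) = b(sⁱ) + b(sʲ) - b(sⁱ⁺ʲ)` follows by induction on `j` from the cocycle identity at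
  `(sⁱ, sʲ, s)`;
* `twoCocycle_addCircle_split_of_isCyclic_of_discreteTopology` — the locally constant form for a
  finite cyclic (discrete) topological group, i.e. `hTate(C)` in the language of
  `TateH2VanishingReduction.lean`.

## References

* J.-P. Serre, *Modular forms of weight one and Galois representations* (Durham 1975), 1977,
  §6.5 (b). [`SerreDurham1977`]
* J.-P. Serre, *Corps locaux* (1968), VIII §4 (cohomology of finite cyclic groups).
  [`SerreLocalFields1979`]
-/

noncomputable section

open Function Finset

namespace Literature.NumberTheory.GaloisRepresentations

section Cyclic

variable {G : Type*} [Group G]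

/-- Sums of an `N`-periodic sequence over `N` consecutive indices agree. [folklore] -/
theorem sum_range_add_sub_sum_range_of_periodic {A : Type*} [AddCommGroup A] {g : ℕ → A} {N : ℕ}
    (hg : ∀ i, g (i + N) = g i) (k : ℕ) :
    ∑ i ∈ range (k + N), g i - ∑ i ∈ range k, g i = ∑ i ∈ range N, g i := by
  induction k with
  | zero => rw [zero_add, sum_range_zero, sub_zero]
  | succ k ih =>
    rw [show k + 1 + N = (k + N) + 1 by ring, sum_range_succ, sum_range_succ, hg k]
    rw [← ih]
    abel

/-- **`H²(C, ℚ/ℤ) = 0` for a finite cyclic group `C` (trivial action), at cocycle level**: every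
`2`-cocycle `f : C × C → ℚ/ℤ` is a coboundary `f(σ,τ) = b(σ) + b(τ) - b(στ)`.
(`H²(C, A) ≅ A/NA = 0` for `A` divisible; here by the explicit recursion along a generator.)
[cite: SerreLocalFields1979, VIII §4] [cite: SerreDurham1977, §6.5 (b)] -/
theorem twoCocycle_addCircle_split_of_isCyclic [Finite G] [IsCyclic G]
    (f : G → G → AddCircle (1 : ℚ))
    (hcoc : ∀ σ τ υ, f σ τ + f (σ * τ) υ = f τ υ + f σ (τ * υ)) :
    ∃ b : G → AddCircle (1 : ℚ), ∀ σ τ, f σ τ + b (σ * τ) = b σ + b τ := by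
  classical
  obtain ⟨s, hs⟩ := IsCyclic.exists_generator (α := G)
  set N : ℕ := orderOf s with hN_def
  have hN : 0 < N := orderOf_pos s
  -- elementary consequences of the cocycle identity
  have h1l : ∀ υ, f 1 υ = f 1 1 := fun υ => by
    have h := hcoc 1 1 υ
    rw [one_mul, one_mul] at h
    exact (add_right_cancel h).symm
  have h1r : ∀ σ, f σ 1 = f 1 1 := fun σ => by
    have h := hcoc σ 1 1
    rw [mul_one, mul_one] at h
    exact add_right_cancel h
  -- the periodic sequence `g i = f(sⁱ, s)` and the constant `c` with `N c = ∑_{i<N} g i`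
  set g : ℕ → AddCircle (1 : ℚ) := fun i => f (s ^ i) s with hg_def
  have hg_per : ∀ i, g (i + N) = g i := fun i => by
    simp only [hg_def]
    rw [pow_add, hN_def, pow_orderOf_eq_one, mul_one]
  obtain ⟨h, hh⟩ := addCircle_exists_fun_nsmul_eq hN
  set c : AddCircle (1 : ℚ) := h (∑ i ∈ range N, g i) with hc_def
  have hc : N • c = ∑ i ∈ range N, g i := hh _
  -- `B(k) = k c - ∑_{i<k} g i + f(1,1)`, `N`-periodic
  set B : ℕ → AddCircle (1 : ℚ) := fun k => k • c - ∑ i ∈ range k, g i + f 1 1 with hB_def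
  have hB0 : B 0 = f 1 1 := by simp [hB_def]
  have hB1 : B 1 = c := by
    simp only [hB_def, one_nsmul, sum_range_one, hg_def, pow_zero]
    rw [h1l s]
    abel
  have hB_succ : ∀ k, B (k + 1) = B k + c - g k := fun k => by
    simp only [hB_def, succ_nsmul, sum_range_succ]
    abel
  have hB_per : ∀ k, B (k + N) = B k := fun k => by
    have e := sum_range_add_sub_sum_range_of_periodic hg_per k
    simp only [hB_def, add_nsmul]
    rw [hc, ← e]
    abel
  have hB_mod : ∀ k, B (k % N) = B k := by
    intro k
    conv_rhs => rw [← Nat.mod_add_div k N]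
    generalize k / N = q
    induction q with
    | zero => rw [mul_zero, add_zero]
    | succ q ih => rw [Nat.mul_succ, ← add_assoc, hB_per, ih]
  -- exponents: every element is `s ^ k`
  have hpow : ∀ x : G, ∃ k : ℕ, s ^ k = x := fun x => by
    have hx : x ∈ Submonoid.powers s :=
      (IsOfFinOrder.mem_powers_iff_mem_zpowers (isOfFinOrder_of_finite s)).2 (hs x)
    exact Submonoid.mem_powers_iff _ _ |>.1 hx
  choose κ hκ using hpow
  -- the cochain `b(sᵏ) = B(k)`
  refine ⟨fun x => B (κ x), ?_⟩
  have hb : ∀ k : ℕ, B (κ (s ^ k)) = B k := fun k => by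
    have h := hκ (s ^ k)
    rw [pow_eq_pow_iff_modEq] at h
    rw [← hB_mod (κ (s ^ k)), ← hB_mod k]
    exact congrArg B h
  -- `f(sⁱ, sʲ) = B i + B j - B (i + j)` by induction on `j`
  have hclaim : ∀ j i : ℕ, f (s ^ i) (s ^ j) = B i + B j - B (i + j) := by
    intro j
    induction j with
    | zero =>
      intro i
      rw [pow_zero, h1r, add_zero, hB0]
      abel
    | succ j ih =>
      intro i
      have e := hcoc (s ^ i) (s ^ j) s
      rw [← pow_add] at e
      have e1 : f (s ^ (i + j)) s = B (i + j) + c - B (i + j + 1) := by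
        have := hB_succ (i + j)
        change g (i + j) = _
        rw [this]
        abel
      have e2 : f (s ^ j) s = B j + c - B (j + 1) := by
        have := hB_succ j
        change g j = _
        rw [this]
        abel
      rw [ih i, e1, e2] at e
      rw [pow_succ, show i + (j + 1) = i + j + 1 by ring]
      -- solve the linear equation `e` for `f (s ^ i) (s ^ j * s)`
      have e' : f (s ^ i) (s ^ j * s) =
          B i + B j - B (i + j) + (B (i + j) + c - B (i + j + 1)) - (B j + c - B (j + 1)) := by
        rw [e]
        abel
      rw [e']
      abel
  intro σ τ
  obtain ⟨i, rfl⟩ : ∃ i, s ^ i = σ := ⟨κ σ, hκ σ⟩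
  obtain ⟨j, rfl⟩ : ∃ j, s ^ j = τ := ⟨κ τ, hκ τ⟩
  change f (s ^ i) (s ^ j) + B (κ (s ^ i * s ^ j)) = B (κ (s ^ i)) + B (κ (s ^ j))
  rw [← pow_add, hb, hb, hb, hclaim j i]
  abel

/-- **`hTate(C)` for a finite cyclic discrete topological group** (e.g. `Gal(ℂ/ℝ)`, `Gal(ℂ/ℂ)`):
every (locally constant) `2`-cocycle `C × C → ℚ/ℤ` is the coboundary of a locally constant
cochain — the archimedean local case of Tate's theorem `H²(G_K, ℚ/ℤ) = 0`, "trivial" in Serre,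
Durham §6.5 (b). [cite: SerreDurham1977, §6.5 (b)] -/
theorem twoCocycle_addCircle_split_of_isCyclic_of_discreteTopology [TopologicalSpace G]
    [DiscreteTopology G] [Finite G] [IsCyclic G] (f : G → G → AddCircle (1 : ℚ))
    (_hf : IsLocallyConstant (Function.uncurry f))
    (hcoc : ∀ σ τ υ, f σ τ + f (σ * τ) υ = f τ υ + f σ (τ * υ)) :
    ∃ b : G → AddCircle (1 : ℚ), IsLocallyConstant b ∧ ∀ σ τ, f σ τ + b (σ * τ) = b σ + b τ := by
  obtain ⟨b, hb⟩ := twoCocycle_addCircle_split_of_isCyclic f hcoc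
  exact ⟨b, IsLocallyConstant.of_discrete b, hb⟩

/-- The `p`-torsion (`(H_p)`) form of `twoCocycle_addCircle_split_of_isCyclic_of_discreteTopology`
(the torsion hypothesis is not needed). [cite: SerreDurham1977, §6.5 (b)] -/
theorem twoCocycle_addCircle_prime_split_of_isCyclic_of_discreteTopology [TopologicalSpace G]
    [DiscreteTopology G] [Finite G] [IsCyclic G] {p : ℕ} (f : G → G → AddCircle (1 : ℚ))
    (_hf : IsLocallyConstant (Function.uncurry f))
    (hcoc : ∀ σ τ υ, f σ τ + f (σ * τ) υ = f τ υ + f σ (τ * υ)) (_hpf : ∀ σ τ, p • f σ τ = 0) :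
    ∃ b : G → AddCircle (1 : ℚ), IsLocallyConstant b ∧ ∀ σ τ, f σ τ + b (σ * τ) = b σ + b τ := by
  obtain ⟨b, hb⟩ := twoCocycle_addCircle_split_of_isCyclic f hcoc
  exact ⟨b, IsLocallyConstant.of_discrete b, hb⟩

end Cyclic

end Literature.NumberTheory.GaloisRepresentations

end
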